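import Mathlib
import Summits.Schanuel.Schanuel.Theses.RigidCore
import Summits.Schanuel.Schanuel.Theorems.RigidCoreMinimalCounterexampleInAclGeThreeSectors
import Summits.Schanuel.Schanuel.Theorems.RigidCoreMinimalCounterexampleInAclDefinableClassSelector
import Summits.Schanuel.Schanuel.Theorems.RigidCoreMinimalCounterexampleInAclArithmeticTransfer
import Summits.Schanuel.Schanuel.Theorems.RigidCoreMinimalCounterexampleInAclNoFullLine
import Summits.Schanuel.Schanuel.Theorems.RigidCoreMinimalCounterexampleInAclHitSetRingDefinable
import Summits.Schanuel.Schanuel.Theorems.RigidCoreMinimalCounterexampleInAclSecondLevelSplit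

/-!
# (S*) ON THE CORANK-ONE SECTOR OF EVERY RANK ≥ 3 IS A THEOREM — ARITHMETIC ISOLATION ASSEMBLED
# (crux stmt-Schanuel-0969 `RigidCore.MinimalCounterexampleInAcl`; item stmt-Schanuel-14744 `MinimalCounterexampleInAclGeThree`)

Line `kernel-arithmetic-selection` (lead prover-line-stmt-Schanuel-0969-c12-0), `--supports stmt-Schanuel-0969`, registered stub
`stub_corankOneSector`.  This file COMPOSES the four landed pieces of the fourth lever (arithmetic isolation, 2026-08-16/17):

* the DEFINABLE-PATTERN SELECTOR `mem_expAcl_of_corankOne_definablePattern` (Theorems/…DefinableClassSelector, p130860): (S*) on the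
  corank-one mixed sector follows from [the hit pattern of `x` has an `∅`-definable copy in `ℂ_exp`] ∧ [no full line of mates];
* the ARITHMETIC TRANSFER `stub_arithmeticTransfer` (Theorems/…ArithmeticTransfer, p130988): subsets of `ℤ^m` definable in the ring `ℤ`
  have `∅`-definable copies in `ℂ_exp` (`ℤ = intSet` with its ring operations is `∅`-definable, KMO 2012 §2.2);
* S9 `stub_corankOne_noFullLine` (Theorems/…NoFullLine, p132838): no non-zero integer direction carries a full line of mates (slice curve,
  coset branch cover, window rigidity, finiteness of kernel classes);
* S8‴ `stub_corankOne_hitSetRingDefinable` (Theorems/…HitSetRingDefinable, p138742, over …HitSetArithmetical{RingDef,Graphs,Representability,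
  ArithHierarchy,Reduction}, …HitSet{BoxArith,BoxArithComplex,Recursion,Isolation,ExpEnclosure,ZeroInBox,Constants}): the hit pattern IS
  ring-definable over `ℤ` (it is arithmetical: `x` is a computable point; Gödel–Kleene representability proved in the tree);

into:

* `corankOne_holds` (registered form `stub_corankOneSector`) — **every coordinate of a normal-form first failure of rank `m + 1 ≥ 3` and
  mixed rank `m` lies in `acl^{ℂ_exp}(∅)`**, unconditionally;
* `geThree_iff_corankGeTwo` — **item stmt-14744 ⟺ its CORANK ≥ 2 sector** (normal form of mixed rank `r ≤ n − 2`), by the landed split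
  `geThree_iff_corankSplit` (Theorems/…GeThreeSectors, c5);
* `crux_iff_pureTwistedResidue_and_corankGeTwo`, `crux_of_pureTwistedResidue_of_corankGeTwo` — **(S*) ⟺ R₃ ∧ [corank ≥ 2]**: the crux is,
  modulo landed theorems, the conjunction of two PURE-SPARSITY-type statements (the rank-2 pure gadget-generic residue R₃ of the twisted
  split p126580, and the relative pure fibres of corank ≥ 2); every sector with a full kernel torsor is settled.

References: status note `Cruxes/MinimalCounterexampleInAcl/Lines/kernel_arithmetic_selection.md` §Addendum c12; crux idea
`Cruxes/MinimalCounterexampleInAcl/Ideas/arithmetic-isolation.md`; [KirbyMacintyreOnshuus2012] §2; [Kirby2010] Prop. 7.2.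
-/

noncomputable section

set_option linter.dupNamespace false

open Complex Set FirstOrder

namespace Summit.Schanuel.Schanuel.Cruxes.MinimalCounterexampleInAcl.KernelArithmeticSelection

open Literature.NumberTheory.Transcendental (SchanuelRank)
open Literature.ModelTheory.ExponentialFields
open Summit.Schanuel.Schanuel.Theorems.AclSubsetLogFreeCore.Negative

variable {n m : ℕ}

/-- The coordinate frame of the first `m` directions of `Fin (m + 1)`: row `k` is the indicator of `Fin.castSucc k`, so the `k`-th integer
combination is the `k`-th coordinate. [folklore] -/
theorem coordFrame_sum (y : Fin (m + 1) → ℂ) (k : Fin m) :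
    (∑ i, (((fun (k : Fin m) (i : Fin (m + 1)) => if i = Fin.castSucc k then (1 : ℤ) else 0) k i : ℤ) : ℂ) * y i) =
      y (Fin.castSucc k) := by
  simp only
  rw [Finset.sum_eq_single (Fin.castSucc k)]
  · simp
  · intro i _ hi; simp [hi]
  · intro h; exact absurd (Finset.mem_univ _) h

/-- **(S*) ON THE CORANK-ONE SECTOR, EVERY RANK ≥ 3 (unconditional).**  A first failure `x` of Schanuel's conjecture of rank `m + 1 ≥ 3` in
normal form of mixed rank `m` (`e^{x_k} ∈ ℚ̄` for `k < m`, pure in the last direction) has all coordinates in `acl^{ℂ_exp}(∅)`: in the coordinate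
frame, the hit pattern is ring-definable over `ℤ` (S8‴), hence `∅`-definable in `ℂ_exp` (transfer), it has no period (S9 + `aperiodic_of_noFullLine`),
so the definable-pattern selector and the acl-field criterion apply (`mem_expAcl_of_corankOne_definablePattern`). [cite: Kirby2010, Prop. 7.2] -/
theorem corankOne_holds :
    ∀ m : ℕ, 2 ≤ m → ∀ x : Fin (m + 1) → ℂ, x ∈ firstFailures (m + 1) →
      (∀ i : Fin (m + 1), (i : ℕ) < m → IsAlgebraic ℚ (cexp (x i))) →
      (∀ M : Fin (m + 1) → ℤ, M (Fin.last m) ≠ 0 → Transcendental ℚ (cexp (∑ i, (M i : ℂ) * x i))) →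
      ∀ i, x i ∈ expAcl := by
  intro m hm x hx halg hpure
  set M : Fin m → Fin (m + 1) → ℤ := fun k i => if i = Fin.castSucc k then 1 else 0 with hM
  have hsum : ∀ (y : Fin (m + 1) → ℂ) (k : Fin m), (∑ i, (M k i : ℂ) * y i) = y (Fin.castSucc k) :=
    fun y k => coordFrame_sum y k
  have hV : {v : Fin m → ℂ | ∃ x' ∈ locusMates x, ∀ k, v k = ∑ i, (M k i : ℂ) * x' i} =
      {v : Fin m → ℂ | ∃ x' ∈ locusMates x, ∀ k, v k = x' (Fin.castSucc k)} := by
    ext v; simp only [Set.mem_setOf_eq, hsum]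
  have hu : (fun k => ∑ i, (M k i : ℂ) * x i) = fun k => x (Fin.castSucc k) := funext fun k => hsum x k
  have hli : LinearIndependent ℚ (fun k => ∑ i, (M k i : ℂ) * x i) := by
    rw [hu]; exact hx.1.comp _ (Fin.castSucc_injective m)
  have halg' : ∀ k, IsAlgebraic ℚ (cexp (∑ i, (M k i : ℂ) * x i)) := fun k => by
    rw [hsum]; exact halg _ (by simp)
  refine mem_expAcl_of_corankOne_definablePattern hx rfl M hli halg' ?_ ?_
  · -- the pattern is arithmetical (S8‴ at Mathlib's ring structure), hence `∅`-definable in `ℂ_exp` (transfer)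
    have hA := @stub_corankOne_hitSetRingDefinable m hm x hx halg hpure (FirstOrder.Ring.compatibleRingOfRing ℤ)
    have hT := stub_arithmeticTransfer m _ hA
    rw [hV]
    convert hT using 1
    ext w
    simp only [Set.mem_setOf_eq, hsum]
    constructor
    · rintro ⟨κ, hw, hκ⟩
      exact ⟨κ, hκ, hw⟩
    · rintro ⟨κ, hκ, hw⟩
      exact ⟨κ, hw, hκ⟩
  · -- no full line (S9)
    intro μ hμ
    obtain ⟨j, hj⟩ := stub_corankOne_noFullLine m hm x hx halg hpure μ hμ
    refine ⟨j, ?_⟩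
    rw [hV]
    simpa only [hsum] using hj

/-- **Item stmt-14744 ⟺ its CORANK ≥ 2 sector.**  By the landed split `geThree_iff_corankSplit` and `corankOne_holds`, (S*) in the ranks
`≥ 3` is equivalent to (S*) for normal-form first failures of rank `n ≥ 3` and mixed rank `r ≤ n − 2` (`e^{x_i} ∈ ℚ̄` for `i < r`, pure in the
remaining `≥ 2` directions) — the sector whose fibres over a `u`-part are RELATIVE PURE problems. [cite: Kirby2010, Prop. 7.2] -/
theorem geThree_iff_corankGeTwo :
    Summit.Schanuel.Schanuel.Theses.RigidCore.MinimalCounterexampleInAclGeThree ↔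
      ∀ (n r : ℕ), 3 ≤ n → r + 2 ≤ n → ∀ x : Fin n → ℂ, x ∈ firstFailures n →
        (∀ i : Fin n, (i : ℕ) < r → IsAlgebraic ℚ (cexp (x i))) →
        (∀ M : Fin n → ℤ, (∃ i : Fin n, r ≤ (i : ℕ) ∧ M i ≠ 0) → Transcendental ℚ (cexp (∑ i, (M i : ℂ) * x i))) →
        ∀ i, x i ∈ expAcl :=
  ⟨fun h => (geThree_iff_corankSplit.1 h).2, fun h => geThree_iff_corankSplit.2 ⟨corankOne_holds, h⟩⟩

/-- **(S*) ⟺ R₃ ∧ [CORANK ≥ 2]** — the crux as the conjunction of its two pure-sparsity-type residues: the rank-2 pure gadget-generic residue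
R₃ of the landed twisted split (`crux_iff_twistedResidue_and_geThree`, p126580) and the corank ≥ 2 sector of item 14744
(`geThree_iff_corankGeTwo`). [cite: Kirby2010, Prop. 7.2] -/
theorem crux_iff_pureTwistedResidue_and_corankGeTwo :
    Summit.Schanuel.Schanuel.Theses.RigidCore.MinimalCounterexampleInAcl ↔
      ((∀ (x : Fin 2 → ℂ), x ∈ firstFailures 2 →
          (∀ M : Fin 2 → ℤ, M ≠ 0 → Transcendental ℚ (cexp (∑ i, (M i : ℂ) * x i))) →
          Transcendental ↥(IntermediateField.adjoin ℚ (range x ∪ range (cexp ∘ x))) (cexp (x 0 ^ 2)) →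
          Transcendental ↥(IntermediateField.adjoin ℚ (range x ∪ range (cexp ∘ x))) (cexp (x 0 * x 1)) →
          Transcendental ↥(IntermediateField.adjoin ℚ (range x ∪ range (cexp ∘ x))) (cexp (x 1 ^ 2)) →
          Transcendental ↥(IntermediateField.adjoin ℚ (range x ∪ range (cexp ∘ x))) (cexp (I * x 0)) →
          Transcendental ↥(IntermediateField.adjoin ℚ (range x ∪ range (cexp ∘ x))) (cexp (I * x 1)) →
          ∀ i, x i ∈ expAcl) ∧
        ∀ (n r : ℕ), 3 ≤ n → r + 2 ≤ n → ∀ x : Fin n → ℂ, x ∈ firstFailures n →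
          (∀ i : Fin n, (i : ℕ) < r → IsAlgebraic ℚ (cexp (x i))) →
          (∀ M : Fin n → ℤ, (∃ i : Fin n, r ≤ (i : ℕ) ∧ M i ≠ 0) → Transcendental ℚ (cexp (∑ i, (M i : ℂ) * x i))) →
          ∀ i, x i ∈ expAcl) := by
  rw [crux_iff_twistedResidue_and_geThree, geThree_iff_corankGeTwo]

/-- **Glue: (S*) from R₃ and the corank ≥ 2 sector** (the gen-27 composition of the line skeleton). [cite: Kirby2010, Prop. 7.2] -/
theorem crux_of_pureTwistedResidue_of_corankGeTwo
    (hR : ∀ (x : Fin 2 → ℂ), x ∈ firstFailures 2 →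
      (∀ M : Fin 2 → ℤ, M ≠ 0 → Transcendental ℚ (cexp (∑ i, (M i : ℂ) * x i))) →
      Transcendental ↥(IntermediateField.adjoin ℚ (range x ∪ range (cexp ∘ x))) (cexp (x 0 ^ 2)) →
      Transcendental ↥(IntermediateField.adjoin ℚ (range x ∪ range (cexp ∘ x))) (cexp (x 0 * x 1)) →
      Transcendental ↥(IntermediateField.adjoin ℚ (range x ∪ range (cexp ∘ x))) (cexp (x 1 ^ 2)) →
      Transcendental ↥(IntermediateField.adjoin ℚ (range x ∪ range (cexp ∘ x))) (cexp (I * x 0)) →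
      Transcendental ↥(IntermediateField.adjoin ℚ (range x ∪ range (cexp ∘ x))) (cexp (I * x 1)) →
      ∀ i, x i ∈ expAcl)
    (hC : ∀ (n r : ℕ), 3 ≤ n → r + 2 ≤ n → ∀ x : Fin n → ℂ, x ∈ firstFailures n →
      (∀ i : Fin n, (i : ℕ) < r → IsAlgebraic ℚ (cexp (x i))) →
      (∀ M : Fin n → ℤ, (∃ i : Fin n, r ≤ (i : ℕ) ∧ M i ≠ 0) → Transcendental ℚ (cexp (∑ i, (M i : ℂ) * x i))) →
      ∀ i, x i ∈ expAcl) :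
    Summit.Schanuel.Schanuel.Theses.RigidCore.MinimalCounterexampleInAcl :=
  crux_iff_pureTwistedResidue_and_corankGeTwo.2 ⟨hR, hC⟩

/-! ## Registered form (`ledger workitem stub-add stmt-Schanuel-0969 --name stub_corankOneSector …`) -/

/-- Registered form of `corankOne_holds` (stub `stub_corankOneSector` of crux stmt-Schanuel-0969, line kernel-arithmetic-selection, lead c12):
(S*) on the corank-one sector of every rank ≥ 3, unconditionally. -/
theorem stub_corankOneSector : ∀ (m : ℕ), 2 ≤ m → ∀ (x : Fin (m + 1) → ℂ), x ∈ Summit.Schanuel.Schanuel.Cruxes.MinimalCounterexampleInAcl.KernelArithmeticSelection.firstFailures (m + 1) → (∀ i : Fin (m + 1), (i : ℕ) < m → IsAlgebraic ℚ (Complex.exp (x i))) → (∀ M : Fin (m + 1) → ℤ, M (Fin.last m) ≠ 0 → Transcendental ℚ (Complex.exp (∑ i, (M i : ℂ) * x i))) → ∀ i, x i ∈ Summit.Schanuel.Schanuel.Theorems.AclSubsetLogFreeCore.Negative.expAcl :=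
  fun m hm x hx halg hpure => corankOne_holds m hm x hx halg hpure

end Summit.Schanuel.Schanuel.Cruxes.MinimalCounterexampleInAcl.KernelArithmeticSelection

end
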